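import Summits.QuantumFields.YangMills.Theorems.AlphaInputsT3ACv3AbelianRegionalLift
import HarnessLib

/-!
# `AlphaInputsT3ACv3AbelianRegionalLiftCurl` — STRATEGY B for 2′, ★★★ (LL) THE LINEAR REGIONAL LIFT: for every region `Ω ⊂ T_η` that is a union of level-`k` blocks and
# every level-`k` one-form `A` there is a finest one-form with EXACT `k`-fold linear (0.4)-averages `A` on every level-`k` bond and curls `≤ 4800·ε·L^{−2k}` at every finest
# square with its corners in `Ω`, `ε` = the largest curl of `A` on the level-`k` plaquettes of `Ω` — lane `pub-balaban3d`, seat alpha-2 (g5)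

WHY (OWNER DEPMAP v3.3; `…v3AbelianFineLift.fineLift_of_linearLift_abelian`, p581514): (FL) `InnerFineLiftsT3` for ABELIAN data ⇐ (LL).  THIS FILE closes (LL): §1 the curl of
the lift `liftT` of `…RegionalLift` componentwise (curl is linear; the twelve identities of `…v3AbelianTensor`; the six faces of every cube regrouped, `sum_faces_eq`); §2 under
the region — all four corners of the finest square in `Ω` — the naive curl cancels against the corner lines (`sum_cl_eq`, the coarse plaquette of the square lies in `Ω` by block
saturation and `coarsen_shift`), full cubes drop out (`phi_eq_zero_of_not_out`), and the hosted cube terms of partial cubes are invisible (`Kc_eq_zero_of_corners`: their host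
corner block is outside `Ω`, the square's corners inside), leaving `Σ_y coef·σ − Σ_{partial} φ·Y^{host}`; §3 the bound `(192 + 6·768)·ε·L^{−2k} = 4800·ε·L^{−2k}`
(`…v3AbelianTensorSigma`); §4 ★★★ `exists_linearLift_region`, in the hypothesis shape consumed by `fineLift_of_linearLift_abelian`.
HONEST FRAMING.  A theorem of finite-dimensional linear algebra on the torus, fully proved; nothing of [B10]∕[7]∕[4] asserted; count-neutral helper toward R3 2′ (`stub_laneRecordsV3`,
items 19935∕19936); registry untouched; nothing about d = 4, the continuum, or a mass gap.

References: T. Bałaban, Commun. Math. Phys. 102 (1985) 277–309 [Balaban1985Variational] ((2), (8) pp.278–279, (11)–(13) pp.279–280); CMP 109 (1987) 249–301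
[Balaban1987RG1] ((0.4), (0.11) p.253).
-/

set_option autoImplicit false

noncomputable section

namespace Summit.QuantumFields.YangMills.Theorems.AbelianEML.Tensor

open scoped BigOperators
open Literature.MathematicalPhysics.QuantumFieldTheory.Balaban1983to89
open Literature.MathematicalPhysics.QuantumFieldTheory.Balaban1983to89.T3ContinuumYM3Torus
open Literature.MathematicalPhysics.QuantumFieldTheory.Balaban1983to89.BlockAveragingEMLProp2 (shift_shift_comm)
open Literature.MathematicalPhysics.QuantumFieldTheory.Balaban1983to89.B10Eq38TorusDomains (toFine)
open Summit.QuantumFields.YangMills.Theorems.AbelianEML.Shapes1D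
open Summit.QuantumFields.Balaban3D.Carriers (coarsen)

variable {F : T3Family} {K k : ℕ}

/-! ## §1 The curl of the lift, componentwise -/

section Curl

variable (Ω : Set (Site (F.P K) 0)) (A : PBond (F.P K) k → ℝ)

/-- The curl of a linear combination over the level-`k` sites. [folklore] -/
theorem curlAt_lincomb (w : Site (F.P K) k → ℝ) (a : Site (F.P K) k → PBond (F.P K) 0 → ℝ) (f : PBond (F.P K) 0 → ℝ)
    (hf : ∀ e, f e = ∑ y : Site (F.P K) k, w y * a y e) (z : Site (F.P K) 0) (α β : Fin 3) :
    curlAt f z α β = ∑ y : Site (F.P K) k, w y * curlAt (a y) z α β := by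
  simp only [curlAt, hf, ← Finset.sum_add_distrib, ← Finset.sum_sub_distrib, ← mul_add, ← mul_sub]

open scoped Classical in
/-- The curl of `liftT` split into its three parts. [folklore] -/
theorem curlAt_liftT (z : Site (F.P K) 0) (α β : Fin 3) :
    curlAt (liftT F K k Ω A) z α β = curlAt (naive F K k A) z α β +
      ∑ y : Site (F.P K) k, (coef F K k Ω A 0 y * curlAt (e01 F K k y) z α β + coef F K k Ω A 1 y * curlAt (e02 F K k y) z α β +
        coef F K k Ω A 2 y * curlAt (e12 F K k y) z α β) +
      ∑ y : Site (F.P K) k, (if Out F K k Ω y then phi F K k Ω A y else 0) * curlAt (rC F K k (host F K k Ω y) y) z α β := by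
  have h1 : curlAt (fun e => ∑ y : Site (F.P K) k, (coef F K k Ω A 0 y * e01 F K k y e + coef F K k Ω A 1 y * e02 F K k y e + coef F K k Ω A 2 y * e12 F K k y e))
      z α β = ∑ y : Site (F.P K) k, (coef F K k Ω A 0 y * curlAt (e01 F K k y) z α β + coef F K k Ω A 1 y * curlAt (e02 F K k y) z α β +
        coef F K k Ω A 2 y * curlAt (e12 F K k y) z α β) := by
    simp only [curlAt, ← Finset.sum_add_distrib, ← Finset.sum_sub_distrib]
    refine Finset.sum_congr rfl fun y _ => ?_
    ring
  have h2 := curlAt_lincomb (fun y => if Out F K k Ω y then phi F K k Ω A y else 0) (fun y => rC F K k (host F K k Ω y) y)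
    (fun e => ∑ y : Site (F.P K) k, (if Out F K k Ω y then phi F K k Ω A y else 0) * rC F K k (host F K k Ω y) y e) (fun _ => rfl) z α β
  unfold liftT
  rw [show (fun b => naive F K k A b + ∑ y : Site (F.P K) k, (coef F K k Ω A 0 y * e01 F K k y b + coef F K k Ω A 1 y * e02 F K k y b + coef F K k Ω A 2 y * e12 F K k y b) +
      ∑ y : Site (F.P K) k, (if Out F K k Ω y then phi F K k Ω A y else 0) * rC F K k (host F K k Ω y) y b) =
      (naive F K k A + fun e => ∑ y : Site (F.P K) k, (coef F K k Ω A 0 y * e01 F K k y e + coef F K k Ω A 1 y * e02 F K k y e + coef F K k Ω A 2 y * e12 F K k y e)) +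
        fun e => ∑ y : Site (F.P K) k, (if Out F K k Ω y then phi F K k Ω A y else 0) * rC F K k (host F K k Ω y) y e from by funext b; rfl,
    curlAt_add, curlAt_add, h1, h2]

/-- **THE PLAQUETTE-CORRECTOR PART, COMPONENT `c`**: `Σ_y coef_c (σ_c − cl_c) − Σ_y φ·K_c` (three face identities and the six-face regrouping). [cite: Balaban1985Variational, (8) p.279] -/
theorem plaq_part (hk : k ≤ K) (c : Fin 3) (z : Site (F.P K) 0) :
    ∑ y : Site (F.P K) k, (coef F K k Ω A 0 y * curlAt (e01 F K k y) z (dirs c).1 (dirs c).2 + coef F K k Ω A 1 y * curlAt (e02 F K k y) z (dirs c).1 (dirs c).2 +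
        coef F K k Ω A 2 y * curlAt (e12 F K k y) z (dirs c).1 (dirs c).2) =
      ∑ y : Site (F.P K) k, coef F K k Ω A c y * (sig F K k c y z - cl F K k c y z) - ∑ y : Site (F.P K) k, phi F K k Ω A y * Kc F K k θ0 0 c y z := by
  rw [sub_eq_add_neg, ← sum_faces_eq Ω A hk c z, ← Finset.sum_add_distrib]
  refine Finset.sum_congr rfl fun y _ => ?_
  fin_cases c
  · simp only [dirs, Fin.zero_eta, Fin.isValue, if_true, curl_e01_01 hk, curl_e02_01 hk, curl_e12_01 hk]
    ring
  · simp only [dirs, Fin.mk_one, Fin.isValue, show ((1 : Fin 3) = 0) = False from by decide, if_true, if_false, curl_e01_02 hk, curl_e02_02 hk, curl_e12_02 hk]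
    ring
  · simp only [dirs, Fin.reduceFinMk, Fin.isValue, show ((2 : Fin 3) = 0) = False from by decide, show ((2 : Fin 3) = 1) = False from by decide, if_false,
      curl_e01_12 hk, curl_e02_12 hk, curl_e12_12 hk]
    ring

open scoped Classical in
/-- **THE CUBE-CORRECTOR PART, COMPONENT `c`**: `Σ_{partial} φ·(K_c − K_c^{host} − Y_c^{host})`. [cite: Balaban1985Variational, (8) p.279] -/
theorem cube_part (hk : k ≤ K) (c : Fin 3) (z : Site (F.P K) 0) :
    ∑ y : Site (F.P K) k, (if Out F K k Ω y then phi F K k Ω A y else 0) * curlAt (rC F K k (host F K k Ω y) y) z (dirs c).1 (dirs c).2 =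
      ∑ y : Site (F.P K) k, (if Out F K k Ω y then phi F K k Ω A y else 0) *
        (Kc F K k θ0 0 c y z - Kc F K k (host F K k Ω y) 0 c y z - Yc F K k (host F K k Ω y) c y z) := by
  refine Finset.sum_congr rfl fun y _ => ?_
  fin_cases c
  · simp only [dirs, Fin.zero_eta, Fin.isValue, if_true, curl_rC_01 hk]
  · simp only [dirs, Fin.mk_one, Fin.isValue, show ((1 : Fin 3) = 0) = False from by decide, if_true, if_false, curl_rC_02 hk]
  · simp only [dirs, Fin.reduceFinMk, Fin.isValue, show ((2 : Fin 3) = 0) = False from by decide, show ((2 : Fin 3) = 1) = False from by decide, if_false, curl_rC_12 hk]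

end Curl

/-! ## §2 Under the region -/

section Region

variable (Ω : Set (Site (F.P K) 0)) (A : PBond (F.P K) k → ℝ)
variable (hk : k ≤ K) (hΩ : ∀ w : Site (F.P K) 0, w ∈ Ω ↔ toFine k (coarsen k w) ∈ Ω)
include hk hΩ

/-- **THE COARSE PLAQUETTE OF A CORNER-LINE SQUARE LIES IN `Ω`**: if the finest square `(z; α, β)` has its four corners in `Ω` and both labels `z_α, z_β` are the last of their
blocks, the level-`k` plaquette `(coarsen k z; α, β)` has its four corner blocks in `Ω`. [cite: Balaban1985UV3, (39) p.266] -/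
theorem plaqIn_coarsen (z : Site (F.P K) 0) {α β : Fin 3} (hαβ : α ≠ β) (hz : z ∈ Ω) (hzα : z.shift α ∈ Ω) (hzβ : z.shift β ∈ Ω) (hzαβ : (z.shift α).shift β ∈ Ω)
    (ha : (z α).val % F.L ^ k = F.L ^ k - 1) (hb : (z β).val % F.L ^ k = F.L ^ k - 1) : PlaqIn F K k Ω (coarsen k z) α β := by
  have hβα : ¬ (@Eq (Fin (F.P K).d) β α) := fun h => hαβ h.symm
  have cα : coarsen k (z.shift α) = (coarsen k z).shift α := by rw [coarsen_shift hk, if_pos ha]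
  have cβ : coarsen k (z.shift β) = (coarsen k z).shift β := by rw [coarsen_shift hk, if_pos hb]
  have cαβ : coarsen k ((z.shift α).shift β) = ((coarsen k z).shift α).shift β := by
    have hb' : ((z.shift α) β).val % F.L ^ k = F.L ^ k - 1 := by rw [Site.shift_apply, if_neg hβα]; exact hb
    rw [coarsen_shift hk, if_pos hb', cα]
  refine ⟨(hΩ z).1 hz, ?_, ?_, ?_⟩
  · rw [← cα]; exact (hΩ _).1 hzα
  · rw [← cβ]; exact (hΩ _).1 hzβ
  · rw [← cαβ]; exact (hΩ _).1 hzαβ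

/-- **THE NAIVE CURL CANCELS AGAINST THE CORNER LINES** under the region. [cite: Balaban1987RG1, (0.4) p.253] -/
theorem naive_sub_cl (c : Fin 3) (z : Site (F.P K) 0) (hz : z ∈ Ω) (hzα : z.shift (dirs c).1 ∈ Ω) (hzβ : z.shift (dirs c).2 ∈ Ω)
    (hzαβ : (z.shift (dirs c).1).shift (dirs c).2 ∈ Ω) :
    curlAt (naive F K k A) z (dirs c).1 (dirs c).2 - ∑ y : Site (F.P K) k, coef F K k Ω A c y * cl F K k c y z = 0 := by
  have hd : (dirs c).1 ≠ (dirs c).2 := by fin_cases c <;> simp [dirs]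
  rw [curl_naive hk A z hd, sum_cl_eq Ω A hk c z]
  split_ifs with h
  · rw [coef, if_pos (plaqIn_coarsen Ω hk hΩ z hd hz hzα hzβ hzαβ h.1 h.2), sub_self]
  · simp

open scoped Classical in
/-- **HOSTED CUBE TERMS OF PARTIAL CUBES ARE INVISIBLE** under the region. [cite: Balaban1985Variational, (8) p.279] -/
theorem Kc_host_eq_zero (c : Fin 3) (y : Site (F.P K) k) (hy : Out F K k Ω y) (z : Site (F.P K) 0) (hz : z ∈ Ω) (hzα : z.shift (dirs c).1 ∈ Ω)
    (hzβ : z.shift (dirs c).2 ∈ Ω) (hzαβ : (z.shift (dirs c).1).shift (dirs c).2 ∈ Ω) : Kc F K k (host F K k Ω y) 0 c y z = 0 := by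
  have hhost : toFine k (corner F K k (host F K k Ω y) y) ∉ Ω := by
    rw [host, dif_pos hy]; exact Classical.choose_spec hy
  have key : ∀ w : Site (F.P K) 0, w ∈ Ω → coarsen k w ≠ corner F K k (host F K k Ω y) y := by
    intro w hw hc; apply hhost; rw [← hc]; exact (hΩ w).1 hw
  obtain ⟨k0, k1, k2⟩ := Kc_eq_zero_of_corners hk (host F K k Ω y) y z
  fin_cases c
  · simp only [dirs, Fin.zero_eta, Fin.isValue, if_true] at hzα hzβ hzαβ ⊢
    exact k0 ⟨key z hz, key _ hzα, key _ hzβ, key _ hzαβ⟩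
  · simp only [dirs, Fin.mk_one, Fin.isValue, show ((1 : Fin 3) = 0) = False from by decide, if_true, if_false] at hzα hzβ hzαβ ⊢
    exact k1 ⟨key z hz, key _ hzα, key _ hzβ, key _ hzαβ⟩
  · simp only [dirs, Fin.reduceFinMk, Fin.isValue, show ((2 : Fin 3) = 0) = False from by decide, show ((2 : Fin 3) = 1) = False from by decide, if_false]
      at hzα hzβ hzαβ ⊢
    exact k2 ⟨key z hz, key _ hzα, key _ hzβ, key _ hzαβ⟩

open scoped Classical in
/-- **★ THE CURL OF THE LIFT UNDER THE REGION**: `curl(liftT)(z; c) = Σ_y coef_c(y)·σ_c(y,z) − Σ_{y partial} φ(y)·Y^{host(y)}_c(y,z)`. [cite: Balaban1985Variational, (8) p.279] -/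
theorem curlAt_liftT_region (c : Fin 3) (z : Site (F.P K) 0) (hz : z ∈ Ω) (hzα : z.shift (dirs c).1 ∈ Ω) (hzβ : z.shift (dirs c).2 ∈ Ω)
    (hzαβ : (z.shift (dirs c).1).shift (dirs c).2 ∈ Ω) :
    curlAt (liftT F K k Ω A) z (dirs c).1 (dirs c).2 = ∑ y : Site (F.P K) k, coef F K k Ω A c y * sig F K k c y z -
      ∑ y : Site (F.P K) k, (if Out F K k Ω y then phi F K k Ω A y else 0) * Yc F K k (host F K k Ω y) c y z := by
  rw [curlAt_liftT, plaq_part Ω A hk, cube_part Ω A hk]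
  have hnc := naive_sub_cl Ω A hk hΩ c z hz hzα hzβ hzαβ
  -- the cube terms: full cubes have `φ = 0`, partial cubes have invisible hosted terms
  have hcube : ∀ y : Site (F.P K) k, (if Out F K k Ω y then phi F K k Ω A y else 0) * (Kc F K k θ0 0 c y z - Kc F K k (host F K k Ω y) 0 c y z - Yc F K k (host F K k Ω y) c y z) -
      phi F K k Ω A y * Kc F K k θ0 0 c y z = -((if Out F K k Ω y then phi F K k Ω A y else 0) * Yc F K k (host F K k Ω y) c y z) := by
    intro y
    by_cases hy : Out F K k Ω y
    · rw [if_pos hy, Kc_host_eq_zero Ω hk hΩ c y hy z hz hzα hzβ hzαβ]; ring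
    · rw [if_neg hy, phi_eq_zero_of_not_out Ω A y hy]; ring
  have hsum := Finset.sum_congr rfl fun (y : Site (F.P K) k) (_ : y ∈ Finset.univ) => hcube y
  rw [Finset.sum_sub_distrib, Finset.sum_neg_distrib] at hsum
  simp only [mul_sub, Finset.sum_sub_distrib] at hnc hsum ⊢
  linarith [hsum]

end Region

/-! ## §3 The bound -/

section Bound

variable (Ω : Set (Site (F.P K) 0)) (A : PBond (F.P K) k → ℝ)
variable (hk : k ≤ K) (hΩ : ∀ w : Site (F.P K) 0, w ∈ Ω ↔ toFine k (coarsen k w) ∈ Ω)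
variable {ε : ℝ} (hε : 0 ≤ ε) (hA : ∀ (y : Site (F.P K) k) (α β : Fin 3), α ≠ β → PlaqIn F K k Ω y α β → |curlAt A y α β| ≤ ε)
include hk hΩ hε hA

omit hk hΩ in
/-- `|coef_c(y)| ≤ ε`. [folklore] -/
theorem abs_coef_le (c : Fin 3) (y : Site (F.P K) k) : |coef F K k Ω A c y| ≤ ε := by
  have hd : (dirs c).1 ≠ (dirs c).2 := by fin_cases c <;> simp [dirs]
  unfold coef
  split_ifs with h
  · exact hA y _ _ hd h
  · rw [abs_zero]; exact hε

omit hk hΩ in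
/-- `|φ(y)| ≤ 6ε`. [folklore] -/
theorem abs_phi_le (y : Site (F.P K) k) : |phi F K k Ω A y| ≤ 6 * ε := by
  have h := abs_coef_le Ω A hε hA
  unfold phi
  calc |coef F K k Ω A 2 (y.shift (0 : Fin 3)) - coef F K k Ω A 2 y - (coef F K k Ω A 1 (y.shift (1 : Fin 3)) - coef F K k Ω A 1 y) +
          (coef F K k Ω A 0 (y.shift (2 : Fin 3)) - coef F K k Ω A 0 y)|
        ≤ |coef F K k Ω A 2 (y.shift (0 : Fin 3)) - coef F K k Ω A 2 y - (coef F K k Ω A 1 (y.shift (1 : Fin 3)) - coef F K k Ω A 1 y)| +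
          |coef F K k Ω A 0 (y.shift (2 : Fin 3)) - coef F K k Ω A 0 y| := abs_add_le _ _
    _ ≤ (|coef F K k Ω A 2 (y.shift (0 : Fin 3)) - coef F K k Ω A 2 y| + |coef F K k Ω A 1 (y.shift (1 : Fin 3)) - coef F K k Ω A 1 y|) +
          (|coef F K k Ω A 0 (y.shift (2 : Fin 3))| + |coef F K k Ω A 0 y|) := add_le_add (abs_sub _ _) (abs_sub _ _)
    _ ≤ ((|coef F K k Ω A 2 (y.shift (0 : Fin 3))| + |coef F K k Ω A 2 y|) + (|coef F K k Ω A 1 (y.shift (1 : Fin 3))| + |coef F K k Ω A 1 y|)) +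
          (|coef F K k Ω A 0 (y.shift (2 : Fin 3))| + |coef F K k Ω A 0 y|) := by gcongr <;> exact abs_sub _ _
    _ ≤ ((ε + ε) + (ε + ε)) + (ε + ε) := by gcongr <;> exact h _ _
    _ = 6 * ε := by ring

open scoped Classical in
/-- **★★ THE CURL BOUND UNDER THE REGION, ORDERED PAIRS**: `|curl(liftT)(z; c)| ≤ 4800·ε·L^{−2k}`. [cite: Balaban1985Variational, (2)+(8) pp.278–279] -/
theorem abs_curlAt_liftT_le (c : Fin 3) (z : Site (F.P K) 0) (hz : z ∈ Ω) (hzα : z.shift (dirs c).1 ∈ Ω) (hzβ : z.shift (dirs c).2 ∈ Ω)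
    (hzαβ : (z.shift (dirs c).1).shift (dirs c).2 ∈ Ω) :
    |curlAt (liftT F K k Ω A) z (dirs c).1 (dirs c).2| ≤ 4800 * ε * (((F.L : ℝ) ^ k)⁻¹) ^ 2 := by
  rw [curlAt_liftT_region Ω A hk hΩ c z hz hzα hzβ hzαβ]
  have h1 : |∑ y : Site (F.P K) k, coef F K k Ω A c y * sig F K k c y z| ≤ ε * (192 * (((F.L : ℝ) ^ k)⁻¹) ^ 2) := by
    calc |∑ y : Site (F.P K) k, coef F K k Ω A c y * sig F K k c y z| ≤ ∑ y : Site (F.P K) k, |coef F K k Ω A c y * sig F K k c y z| := Finset.abs_sum_le_sum_abs _ _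
      _ ≤ ∑ y : Site (F.P K) k, ε * |sig F K k c y z| := Finset.sum_le_sum fun y _ => by
          rw [abs_mul]; exact mul_le_mul_of_nonneg_right (abs_coef_le Ω A hε hA c y) (abs_nonneg _)
      _ = ε * ∑ y : Site (F.P K) k, |sig F K k c y z| := by rw [Finset.mul_sum]
      _ ≤ ε * (192 * (((F.L : ℝ) ^ k)⁻¹) ^ 2) := mul_le_mul_of_nonneg_left (sum_abs_sig_le hk c z) hε
  have h2 : |∑ y : Site (F.P K) k, (if Out F K k Ω y then phi F K k Ω A y else 0) * Yc F K k (host F K k Ω y) c y z| ≤ 6 * ε * (768 * (((F.L : ℝ) ^ k)⁻¹) ^ 2) := by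
    calc |∑ y : Site (F.P K) k, (if Out F K k Ω y then phi F K k Ω A y else 0) * Yc F K k (host F K k Ω y) c y z|
        ≤ ∑ y : Site (F.P K) k, |(if Out F K k Ω y then phi F K k Ω A y else 0) * Yc F K k (host F K k Ω y) c y z| := Finset.abs_sum_le_sum_abs _ _
      _ ≤ ∑ y : Site (F.P K) k, 6 * ε * |Yc F K k (host F K k Ω y) c y z| := Finset.sum_le_sum fun y _ => by
          rw [abs_mul]
          refine mul_le_mul_of_nonneg_right ?_ (abs_nonneg _)
          split_ifs with hy
          · exact abs_phi_le Ω A hε hA y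
          · rw [abs_zero]; positivity
      _ = 6 * ε * ∑ y : Site (F.P K) k, |Yc F K k (host F K k Ω y) c y z| := by rw [Finset.mul_sum]
      _ ≤ 6 * ε * (768 * (((F.L : ℝ) ^ k)⁻¹) ^ 2) := mul_le_mul_of_nonneg_left (sum_abs_Yc_le hk (host F K k Ω) c z) (by positivity)
  calc |∑ y : Site (F.P K) k, coef F K k Ω A c y * sig F K k c y z -
          ∑ y : Site (F.P K) k, (if Out F K k Ω y then phi F K k Ω A y else 0) * Yc F K k (host F K k Ω y) c y z|
      ≤ |∑ y : Site (F.P K) k, coef F K k Ω A c y * sig F K k c y z| +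
          |∑ y : Site (F.P K) k, (if Out F K k Ω y then phi F K k Ω A y else 0) * Yc F K k (host F K k Ω y) c y z| := abs_sub _ _
    _ ≤ ε * (192 * (((F.L : ℝ) ^ k)⁻¹) ^ 2) + 6 * ε * (768 * (((F.L : ℝ) ^ k)⁻¹) ^ 2) := add_le_add h1 h2
    _ = 4800 * ε * (((F.L : ℝ) ^ k)⁻¹) ^ 2 := by ring

omit hk hΩ hε hA in
/-- Antisymmetry of the curl. [folklore] -/
theorem curlAt_swap (a : PBond (F.P K) 0 → ℝ) (z : Site (F.P K) 0) (μ ν : Fin 3) : curlAt a z ν μ = -curlAt a z μ ν := by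
  simp only [curlAt]; ring

/-- **★★ THE CURL BOUND UNDER THE REGION, ALL PAIRS.** [cite: Balaban1985Variational, (2)+(8) pp.278–279] -/
theorem abs_curlAt_liftT_le' (z : Site (F.P K) 0) (μ ν : Fin 3) (hμν : μ ≠ ν) (hz : z ∈ Ω) (hzμ : z.shift μ ∈ Ω) (hzν : z.shift ν ∈ Ω)
    (hzμν : (z.shift μ).shift ν ∈ Ω) : |curlAt (liftT F K k Ω A) z μ ν| ≤ 4800 * ε * (((F.L : ℝ) ^ k)⁻¹) ^ 2 := by
  have main := abs_curlAt_liftT_le Ω A hk hΩ hε hA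
  have hνμ : (z.shift ν).shift μ ∈ Ω := by rw [shift_shift_comm]; exact hzμν
  fin_cases μ <;> fin_cases ν
  · exact absurd rfl hμν
  · exact main 0 z hz hzμ hzν hzμν
  · exact main 1 z hz hzμ hzν hzμν
  · rw [curlAt_swap, abs_neg]; exact main 0 z hz hzν hzμ hνμ
  · exact absurd rfl hμν
  · exact main 2 z hz hzμ hzν hzμν
  · rw [curlAt_swap, abs_neg]; exact main 1 z hz hzν hzμ hνμ
  · rw [curlAt_swap, abs_neg]; exact main 2 z hz hzν hzμ hνμ
  · exact absurd rfl hμν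

end Bound

/-! ## §4 (LL): the linear regional lift -/

/-- **★★★ (LL) THE LINEAR REGIONAL LIFT.**  Let `Ω ⊂ T_η` be a union of level-`k` blocks (`w ∈ Ω ↔` the centre of its level-`k` block is in `Ω`), `A` a one-form on the level-`k`
bonds and `ε ≥ 0` a bound for `|curl A|` at every level-`k` plaquette whose four corner blocks lie in `Ω`.  Then there is a finest one-form `a` with EXACT `k`-fold linear
(0.4)-averages `linAvgIter k a = A` on every level-`k` bond and `|curl a| ≤ 4800·ε·L^{−2k}` at every finest square whose four corners lie in `Ω` (`k ≤ K`).  This is the linear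
(abelian) content of the non-emptiness of [Balaban1985Variational]'s constraint space (8) for one region with free boundary; with `…v3AbelianFineLift.fineLift_of_linearLift_abelian`
it gives (FL) for abelian data. [cite: Balaban1985Variational, (2)+(3)+(8) pp.278–279] -/
theorem exists_linearLift_region (hk : k ≤ K) (Ω : Set (Site (F.P K) 0)) (hΩ : ∀ w : Site (F.P K) 0, w ∈ Ω ↔ toFine k (coarsen k w) ∈ Ω)
    (A : PBond (F.P K) k → ℝ) {ε : ℝ} (hε : 0 ≤ ε)
    (hA : ∀ (y : Site (F.P K) k) (α β : Fin 3), α ≠ β →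
      toFine k y ∈ Ω → toFine k (y.shift α) ∈ Ω → toFine k (y.shift β) ∈ Ω → toFine k ((y.shift α).shift β) ∈ Ω → |curlAt A y α β| ≤ ε) :
    ∃ a : PBond (F.P K) 0 → ℝ, (∀ b : PBond (F.P K) k, linAvgIter k a b = A b) ∧
      ∀ (z : Site (F.P K) 0) (μ ν : Fin 3), μ ≠ ν → z ∈ Ω → z.shift μ ∈ Ω → z.shift ν ∈ Ω → (z.shift μ).shift ν ∈ Ω →
        |curlAt a z μ ν| ≤ 4800 * ε * (((F.L : ℝ) ^ k)⁻¹) ^ 2 := by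
  have hA' : ∀ (y : Site (F.P K) k) (α β : Fin 3), α ≠ β → PlaqIn F K k Ω y α β → |curlAt A y α β| ≤ ε :=
    fun y α β hne hP => hA y α β hne hP.1 hP.2.1 hP.2.2.1 hP.2.2.2
  refine ⟨lift F K k Ω A hk, linAvgIter_lift Ω A hk, fun z μ ν hμν hz hzμ hzν hzμν => ?_⟩
  rw [curlAt_lift]
  exact abs_curlAt_liftT_le' Ω A hk hΩ hε hA' z μ ν hμν hz hzμ hzν hzμν

end Summit.QuantumFields.YangMills.Theorems.AbelianEML.Tensor

end
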